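import Summits.CriticalPhenomena.CardyFormulaZ2.Theorems.CardyIKTransportIKLinearTransportTransportDefs
import Summits.CriticalPhenomena.CardyFormulaZ2.Theorems.CardyIKTransportIKMixedBoxCrossingStubMirrorBasics

/-!
# `stub_FarRSWWhite` (crux stmt-CriticalPhenomena-5076, line `pinned-diagram-exchange`, skeleton v15,
# piece A2): the far-conditioned RSW family for WHITE from the family for BLACK

Support file (`--supports stmt-CriticalPhenomena-5076`, registered stub `stub_FarRSWWhite`).

The a-priori input of the window-transport core (Manolescu, arXiv:2502.08394 §5.3) includes the
far-conditioned RSW family `FarRSWBound` at all aspect ratios: given any event `E` determined by the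
cells at sup-distance `≥ n` from a `w × h` box, the box is crossed by BLACK paths both ways and is
surrounded by a black ring (dual form: no WHITE path from the box reaches sup-distance `≥ n`), each with
`ν_S`-probability `≥ c · ν_S(E)`.  The core needs the same three bounds for WHITE.  They follow from the
COLOUR-FLIP SYMMETRY of every `ν_S = μIK.map (obs S)`: complementing the column-sign bits `ω.2.1`
preserves `μIK` (`MirrorBasics.measurePreserving_flipB`) and complements the colour of every cell while
keeping the diagonals (`MirrorBasics.obs_flipB`), hence `(ν_S).map (x ↦ (x.1ᶜ, x.2)) = ν_S`
(`FarRSWWhite.map_flip_νmix`).  Apply the black family to the flipped event `E' := flip ⁻¹' E`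
(measurable and far-determined, since `determinedOn Λ` only reads memberships of the cells/faces of `Λ`)
and transport each of the three inequalities back through the measure-preserving involution `flip`
(`MeasurePreserving.measure_preimage_equiv`, valid for EVERY set, so no measurability of the crossing
events is needed); for the ring clause, the white paths of `x` are the black paths of `flip x`
(`FarRSWWhite.monoPaths_flip_true`: `cellGraph` reads the diagonals `x.2` only).
-/

noncomputable section

namespace Summit.CriticalPhenomena.CardyFormulaZ2.Theorems.IKLinearTransport.PinnedDiagramExchange

open scoped BigOperators Topology Classical MeasureTheory ProbabilityTheory ENNReal symmDiff
open Filter Set Function MeasureTheory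
open Literature.Probability.Percolation Literature.Probability.LatticeModels
open Literature.Probability.RandomPlanarGeometry

namespace FarRSWWhite

open Summit.CriticalPhenomena.CardyFormulaZ2.Cruxes.IKMixedBoxCrossing.PairedMirrorExploration
  (MirrorBasics.measurePreserving_flipB MirrorBasics.obs_flipB)

/-- The colour flip on observables `x ↦ (x.1ᶜ, x.2)` (black cells complemented, diagonals kept) is an
involution. [folklore] -/
theorem flip_involutive : Function.Involutive fun x : Obs => (x.1ᶜ, x.2) := fun x => by
  simp only [compl_compl, Prod.mk.eta]

/-- The colour flip on observables is measurable. [folklore] -/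
theorem measurable_flip : Measurable fun x : Obs => (x.1ᶜ, x.2) :=
  (measurable_compl.comp measurable_fst).prodMk measurable_snd

/-- COLOUR-FLIP SYMMETRY OF EVERY `ν_S`: complementing the column-sign bits preserves `μIK` and
complements the colours of all cells (landed `MirrorBasics.measurePreserving_flipB` / `obs_flipB`), so
the law of the observables is invariant under the colour flip. [folklore] -/
theorem map_flip_νmix (S : Set ℤ) : (νmix S).map (fun x : Obs => (x.1ᶜ, x.2)) = νmix S := by
  rw [νmix, Measure.map_map measurable_flip (CouplingToLimits.measurable_obs S)]
  have h : ((fun x : Obs => (x.1ᶜ, x.2)) ∘ obs S) =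
      obs S ∘ fun ω : Ω => ((ω.1, ω.2.1ᶜ, ω.2.2) : Ω) :=
    funext fun ω => (MirrorBasics.obs_flipB S ω).symm
  rw [h, ← Measure.map_map (CouplingToLimits.measurable_obs S)
    MirrorBasics.measurePreserving_flipB.measurable, MirrorBasics.measurePreserving_flipB.map_eq]

/-- The colour flip preserves the `ν_S`-measure of EVERY set (it is a measure-preserving measurable
involution). [folklore] -/
theorem νmix_preimage_flip (S : Set ℤ) (A : Set Obs) :
    νmix S ((fun x : Obs => (x.1ᶜ, x.2)) ⁻¹' A) = νmix S A :=
  MeasurePreserving.measure_preimage_equiv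
    (f := MeasurableEquiv.ofInvolutive (fun x : Obs => (x.1ᶜ, x.2)) flip_involutive measurable_flip)
    ⟨measurable_flip, map_flip_νmix S⟩ A

/-- The colour flip preserves the `ν_S`-probability of every set (`Measure.real` form). [folklore] -/
theorem νmix_real_preimage_flip (S : Set ℤ) (A : Set Obs) :
    (νmix S).real ((fun x : Obs => (x.1ᶜ, x.2)) ⁻¹' A) = (νmix S).real A := by
  rw [measureReal_def, measureReal_def, νmix_preimage_flip]

/-- Far-determined events stay far-determined under the colour flip (`determinedOn Λ` only reads the
memberships of the cells/faces of `Λ`). [folklore] -/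
theorem preimage_flip_mem_determinedOn {Λ : Set (Site 2)} {E : Set Obs} (hE : E ∈ determinedOn Λ) :
    (fun x : Obs => (x.1ᶜ, x.2)) ⁻¹' E ∈ determinedOn Λ := fun _ _ hxy =>
  hE _ _ fun v hv => ⟨not_congr (hxy v hv).1, (hxy v hv).2⟩

/-- White paths are the black paths of the colour-flipped configuration (the triangulation `cellGraph`
reads the diagonals `x.2` only). [folklore] -/
theorem monoPaths_flip_true (x : Obs) : monoPaths (x.1ᶜ, x.2) true = monoPaths x false := by
  ext p
  simp only [monoPaths, Set.mem_setOf_eq, Set.mem_compl_iff, iff_true, Bool.false_eq_true, iff_false]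

/-- The left–right crossing event read after the colour flip, pulled back by the flip, is the
crossing event itself. [folklore] -/
theorem preimage_flip_setOf_flip_mem (A : Set Obs) :
    (fun x : Obs => (x.1ᶜ, x.2)) ⁻¹' {x : Obs | (x.1ᶜ, x.2) ∈ A} = A := by
  ext x
  simp only [Set.mem_preimage, Set.mem_setOf_eq, compl_compl, Prod.mk.eta]

/-- The black-ring event (no black path from the box reaches far), pulled back by the flip, is the
white-ring event of the hypothesis family. [folklore] -/
theorem preimage_flip_ring (a b : ℤ) (w h n : ℕ) :
    (fun x : Obs => (x.1ᶜ, x.2)) ⁻¹' {x : Obs | ∀ p ∈ monoPaths x true,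
        (∃ u ∈ p, a ≤ u 0 ∧ u 0 < a + w ∧ b ≤ u 1 ∧ u 1 < b + h) → ∀ v ∈ p, v ∉ farFrom a b w h n} =
      {x : Obs | ∀ p ∈ monoPaths x false,
        (∃ u ∈ p, a ≤ u 0 ∧ u 0 < a + w ∧ b ≤ u 1 ∧ u 1 < b + h) → ∀ v ∈ p, v ∉ farFrom a b w h n} := by
  ext x
  simp only [Set.mem_preimage, Set.mem_setOf_eq, monoPaths_flip_true]

/-- TRANSPORT OF ONE CONDITIONAL LOWER BOUND through the colour flip: a bound for the flipped event
`flip ⁻¹' E` intersected with `flip ⁻¹' A` is a bound for `E ∩ A`. [folklore] -/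
theorem transport {S : Set ℤ} {c : ℝ} {E A : Set Obs}
    (h : c * (νmix S).real ((fun x : Obs => (x.1ᶜ, x.2)) ⁻¹' E) ≤
      (νmix S).real ((fun x : Obs => (x.1ᶜ, x.2)) ⁻¹' E ∩ (fun x : Obs => (x.1ᶜ, x.2)) ⁻¹' A)) :
    c * (νmix S).real E ≤ (νmix S).real (E ∩ A) := by
  have h1 := νmix_real_preimage_flip S E
  have h2 := νmix_real_preimage_flip S (E ∩ A)
  rw [Set.preimage_inter] at h2
  rwa [h1, h2] at h

end FarRSWWhite

/-- PIECE A2 · `stub_FarRSWWhite` (PROVED) — THE FAR-CONDITIONED RSW FAMILY FOR WHITE: from the family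
for black (`FarRSWBound` at all aspect ratios `≤ k`), for every event `E` determined at sup-distance
`≥ n` from the `w × h` box, the box is crossed both ways by WHITE paths and surrounded by a WHITE ring
(no black path from the box reaches sup-distance `≥ n`), each with `ν_S`-probability `≥ c · ν_S(E)`,
with the SAME constant `c = c(k)`.  Colour-flip symmetry of every `ν_S` (`FarRSWWhite.map_flip_νmix`)
applied to the flipped event. [folklore] -/
theorem stub_FarRSWWhite :
    (∀ k : ℕ, ∃ c : ℝ, 0 < c ∧ ∀ (S : Set ℤ) (n : ℕ), 1 ≤ n → ∀ (a b : ℤ) (w h : ℕ),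
        n ≤ w → w ≤ k * n → n ≤ h → h ≤ k * n → ∀ E : Set Obs, MeasurableSet E →
        FarRSWBound c S n a b w h E) →
    ∀ k : ℕ, ∃ c : ℝ, 0 < c ∧ ∀ (S : Set ℤ) (n : ℕ), 1 ≤ n → ∀ (a b : ℤ) (w h : ℕ),
      n ≤ w → w ≤ k * n → n ≤ h → h ≤ k * n → ∀ E : Set Obs, MeasurableSet E →
      E ∈ determinedOn (farFrom a b w h n) →
      c * (νmix S).real E ≤ (νmix S).real (E ∩ {x | (x.1ᶜ, x.2) ∈ lrCross a b w h}) ∧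
      c * (νmix S).real E ≤ (νmix S).real (E ∩ {x | (x.1ᶜ, x.2) ∈ tbCross a b w h}) ∧
      c * (νmix S).real E ≤ (νmix S).real (E ∩ {x | ∀ p ∈ monoPaths x true,
        (∃ u ∈ p, a ≤ u 0 ∧ u 0 < a + w ∧ b ≤ u 1 ∧ u 1 < b + h) → ∀ v ∈ p, v ∉ farFrom a b w h n}) := by
  intro hFar k
  obtain ⟨c, hc, hB⟩ := hFar k
  refine ⟨c, hc, fun S n hn a b w h h1 h2 h3 h4 E hE hdet => ?_⟩
  have hE' : MeasurableSet ((fun x : Obs => (x.1ᶜ, x.2)) ⁻¹' E) := FarRSWWhite.measurable_flip hE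
  obtain ⟨hlr, htb, hring⟩ := hB S n hn a b w h h1 h2 h3 h4 _ hE'
    (FarRSWWhite.preimage_flip_mem_determinedOn hdet)
  refine ⟨FarRSWWhite.transport ?_, FarRSWWhite.transport ?_, FarRSWWhite.transport ?_⟩
  · rw [FarRSWWhite.preimage_flip_setOf_flip_mem]
    exact hlr
  · rw [FarRSWWhite.preimage_flip_setOf_flip_mem]
    exact htb
  · rw [FarRSWWhite.preimage_flip_ring]
    exact hring

end Summit.CriticalPhenomena.CardyFormulaZ2.Theorems.IKLinearTransport.PinnedDiagramExchange

end
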